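import Literature.Barriers.NavierStokesRegularity.HypodissipativeLerayNonuniquenessDeRosaProofs
import Literature.Analysis.FluidPDE.FracNSShortTimeExistence
import Literature.Analysis.FluidPDE.DeRosaPerturbationHolds
import HarnessLib

/-!
# De Rosa 2019, Thm. 1.2 holds — discharge of the named fact `DeRosa2019_thm12`

Definition-free sibling (theorems only) of
`Literature/Barriers/NavierStokesRegularity/HypodissipativeLerayNonuniqueness` (D-0021).
L. De Rosa, *Infinitely many Leray–Hopf solutions for the fractional Navier–Stokes equations*,
Comm. PDE 44 (2019) 335–365 = arXiv:1801.10235, **Thm. 1.2** (p. 3 of the arXiv text): for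
`0 < γ < 1/3` there are divergence-free `L²` initial data with infinitely many Leray
solutions of the fractional Navier–Stokes equations `∂ₜv + div(v ⊗ v) + ∇p + (-Δ)^γ v = 0`
on `T³`.

The printed proof (§2, p. 5) is the assembly "Thm. 2.1 (prescribed kinetic energy, applied to the
family of profiles `𝓔_K`) + Cor. 7.2 (the dissipation is dominated by the energy drop, so the
solutions satisfy the energy inequality on `[0, T]`) + Thm. 1.1 (prolongation by a Leray solution
after time `T`)". That assembly is proved in the tree as
`DeRosa2019_thm12_of_thm21 : DeRosa2019_thm21 → DeRosa2019_thm12`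
(`HypodissipativeLerayNonuniquenessDeRosaProofs`, with Cor. 7.2, Thm. 1.1 =
`ColomboDeLellisDeRosa2018_thm11_holds` and the prolongation step discharged, and the profile
family of `FractionalNSPrescribedEnergyProfiles`). Thm. 2.1 in turn is proved in §4.2 from the
inductive Prop. 4.1, whose proof (§5) has three stages; in the tree
`DeRosa2019_thm21_of_gluing_of_perturbation` (same file: §4.2 with the time-regularity step and
the mollification stage discharged) reduces it to the gluing stage (§5.2) and the perturbation
stage (§§5.3–5.5), discharged as `DeRosa.gluingStage_holds` (`FracNSShortTimeExistence`:
short-time smooth solutions of the fractional Navier–Stokes equations, Thm. 3.4 / Prop. 3.5, the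
stability estimates and the glued triple of Props. 5.3–5.5 with the commutator estimate
`BDSV.commutatorCZBound_holds`) and `DeRosa.perturbationStage_holds`
(`DeRosaPerturbationHolds`, Props. 5.11–5.13). This file composes the three (the same term as
`DeRosa2019_thm12_of_thm21 DeRosa2019_thm21_holds` with the sibling discharge
`FractionalNSPrescribedEnergyHolds` unfolded). The trust base of `DeRosa2019_thm12_holds` is
Mathlib's (`propext`, `Classical.choice`, `Quot.sound`).

## References

* L. De Rosa, *Infinitely many Leray–Hopf solutions for the fractional Navier–Stokes equations*,
  Comm. PDE 44 (2019) 335–365, doi:10.1080/03605302.2018.1547745 = arXiv:1801.10235: §1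
  Thm. 1.2; §2 Thm. 2.1 and the proof of Thm. 1.2 (p. 5); §4 Prop. 4.1 and §4.2; §5; §7
  Cor. 7.2. [`Derosa2018`]
* M. Colombo, C. De Lellis, L. De Rosa, *Ill-posedness of Leray solutions for the hypodissipative
  Navier–Stokes equations*, Comm. Math. Phys. 362 (2018) 659–688, Thm. 1.1 (Leray existence, the
  prolongation step). [`ColomboDeLellisDeRosa2018`]
-/

namespace Literature.Barriers.NavierStokesRegularity

/-- **De Rosa 2019, Thm. 1.2, discharged**: for every `0 < γ < 1/3` there is a divergence-free
`L²` initial datum on `T³` admitting infinitely many Leray solutions of the fractional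
Navier–Stokes equations with dissipation `(-Δ)^γ`. Proof: the printed assembly of §2
(`DeRosa2019_thm12_of_thm21`: Thm. 2.1 on the profiles `𝓔_K`, the energy inequality from
Cor. 7.2, prolongation by Thm. 1.1) fed with Thm. 2.1, itself obtained (§4.2, §5) from the
discharged gluing and perturbation stages of Prop. 4.1
(`DeRosa2019_thm21_of_gluing_of_perturbation`, `DeRosa.gluingStage_holds`,
`DeRosa.perturbationStage_holds`).
[cite: Derosa2018, §1 Thm. 1.2; §2 (proof of Thm. 1.2, p. 5); §4.2; §5] -/
theorem DeRosa2019_thm12_holds : DeRosa2019_thm12 :=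
  DeRosa2019_thm12_of_thm21
    (DeRosa2019_thm21_of_gluing_of_perturbation
      Literature.Analysis.FluidPDE.DeRosa.gluingStage_holds
      Literature.Analysis.FluidPDE.DeRosa.perturbationStage_holds)

end Literature.Barriers.NavierStokesRegularity
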